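/-
Origin: expansion seat `prover-pub-hodgecm-mc-binder-2-g11-0`, handover #32 2026-08-20T02:20Z md5 7939981d086e (268 l.; CERTIFIED rc 0 / 0 warn / 24.4 s; imports RUN-36 `HypCensus/ArchDatumPlacesCMSigns` + RUN-37 `HypCensus/InsBlock` + PKG-present twins `SegalBargmann/SchwartzCompactWeilDatum`, `…/SchwartzBargmannIntertwining`, `Weil1964/ArchFollandCompactKType`, `…/ArchFollandKroneckerRows`, `…/ArchVacuumSectionPlaces`; THE ENGINE: §2 generic `piPhaseHom_eq_realifySp_placeBlock` (several-places form of the tree's `piPhaseHom_mulSingle_eq_realifySp`), `linSubst_star_placeBlock_rename_atPlace`/`_prod_rename_atPlace` (the substitution by a place-block unitary acts place by place), `linSubst_star_reindexUnitary_rename` (transport along a variable bijection); §1 abbrev **`cmPlaceComponent v`** `:= (archPairPlace … v).comp archProdHom : arch J_V × arch J_W →* Ginf (PosIdx x_V) (NegIdx x_V) (PosIdx x_W) (NegIdx x_W)`, `cmArchPairPhaseHom_apply` (rfl: the pin's (J-arch) phase hom IS `piPhaseHom pairFrame ι𝕎` along the components); §3 abbrev `cmLetterBlock k h := placeBlock (v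 ↦ (dualPairι (k v h))^{pairFrame v})` (+ `_apply` rfl), `cmArchPairPhaseHom_eq_realifySp_of_components`, **`exists_character_cmArchWeilRep_follandFock`**: under the four sign facts, for `κ₀ : H →* arch×arch` continuous with components `κ (k v h)` at EVERY place: ∃ ONE continuous `χ : H →* Circle`, `cmArchWeilRep (κ₀ h) (follandFock cmBigFrame G) = χ h • follandFock cmBigFrame (linSubst (star (cmLetterBlock k h)) G)` for every Fock polynomial `G` (tree `IsArchWeilDatum.exists_eq_compactWeilRep` [Folland1989 Prop. (4.39)] on the whole pin datum `isArchWeilDatum_repTransport_cmArchWeilRep_of_signs` — NO small datum of any block shape, NO product of sections), `character_pinned_by_vacuum`; NAME LIST `HodgeCM.Model.HypCensus.exists_character_cmArchWeilRep_follandFock`, `HodgeCM.Model.HypCensus.cmPlaceComponent`, `HodgeCM.Model.HypCensus.cmArchPairPhaseHom_apply`; axioms trio) (`HOME/mc/pub-hodgecm-mc-binder-2/g11/pkg/HodgeCM/Model/HypCensus/CompactLetters.lean`, md5 7939981d086e, 268 lines);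
landed by the gen-14 packager (p-g14) in gate run 39 as `HodgeCM/Model/HypCensus/CompactLetters.lean` (verbatim).
-/
/-
Origin: speedrun cell pub-hodgecm, MODEL-CONSTRUCTION sub-cell, lineage mc-binder-2 (BINDER-OWNERS rows 18/19: E binders
`hyp12` / `hyp34` of `Model.perL_picardCM_r15A`), seat prover-pub-hodgecm-mc-binder-2-g11-0 (gen 11), 2026-08-20.
Target in PKG: `HodgeCM/Model/HypCensus/CompactLetters.lean` (NEW additive leaf; imports this lineage's RUN-36/37 INSTALLED
`HypCensus/ArchDatumPlacesCMSigns`, `HypCensus/ArchDatumBlockCM` and the PKG-present twins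
`Analysis/SegalBargmann/SchwartzCompactWeilDatum`, `…/SchwartzBargmannIntertwining`, `Weil1964/ArchFollandCompactKType`,
`Weil1964/ArchFollandKroneckerRows`, `Weil1964/ArchVacuumSectionPlaces`).
KERNEL ONLY: 0 records, nothing cited as hypothesis, 0 `def … : Prop`; one `abbrev` (a monoid hom) + theorems.
-/
import Summits.HodgeConjecture.HodgeCM.Model.HypCensus.ArchDatumPlacesCMSigns
import Summits.HodgeConjecture.HodgeCM.Model.HypCensus.InsBlock
import Literature.Analysis.SegalBargmann.SchwartzCompactWeilDatum
import Literature.Analysis.SegalBargmann.SchwartzBargmannIntertwining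
import Literature.NumberTheory.Weil1964.ArchFollandCompactKType
import Literature.NumberTheory.Weil1964.ArchFollandKroneckerRows
import Literature.NumberTheory.Weil1964.ArchVacuumSectionPlaces

/-!
# Census kit (rows A12/A34): compact letters AT ALL PLACES AT ONCE — one character, place-by-place substitution

The census fields `omg_ins` ((J-T12)/(J-T34): the archimedean torus `T(L⁺ ⊗ ℝ)`) and `ins_mem` ((J-x₀): the compact group
`K_∞`) both ask how an ARCHIMEDEAN element of the pair group, COMPACT at every real place, acts on an inserted printed pure
tensor `E(follandFock 𝔢 (∏_w placePoly_w) ⊗ f)` (`HypCensus/Ins`).  The single-place kernel of the lineage (`KappaEigen`,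
LEMMA B) needs a small Weil datum of every block shape and a product-of-sections bookkeeping; this leaf replaces both by ONE
application of the tree's compact rigidity of an abstract archimedean Weil datum
(`IsArchWeilDatum.exists_eq_compactWeilRep`, [Folland1989, Prop. (4.39)]) to the (J-arch) datum OF THE WHOLE PIN
(`isArchWeilDatum_repTransport_cmArchWeilRep_of_signs`, canonical frames):

* §1 `cmPlaceComponent v : arch J_V × arch J_W →* U(P_v,Q_v) × U(R_v,S_v)` — the place components of an archimedean pair
  element in the canonical block frames of the pin (tree `archPairPlace v ∘ archProdHom`); `cmArchPairPhaseHom_apply` — the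
  (J-arch) phase homomorphism of the pin IS `piPhaseHom` of Konno–Konno's `ι𝕎` along these components (`rfl`).
* §2 `piPhaseHom_eq_realifySp_placeBlock` — if EVERY component acts by a realified unitary `U v`, the whole element acts by
  the realified block unitary `placeBlock (v ↦ (U v)^{ε v})` (several-places form of the tree's
  `piPhaseHom_mulSingle_eq_realifySp`); `linSubst_star_placeBlock_rename_atPlace` / `…_prod` — the induced substitution
  `F ↦ F ∘ (placeBlock U)⁻¹` acts PLACE BY PLACE on products of place polynomials.
* §3 **`exists_character_cmArchWeilRep_follandFock`** (HEADLINE): for a topological group `H` mapped continuously into the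
  archimedean pair group by `κ₀` so that every place component is a compact letter `κ (k_v h)` (`k_v : H →* K_{V,v} × K_{W,v}`),
  there is ONE continuous unitary character `χ : H →* S¹` with
  `ω_∞(κ₀ h) (follandFock 𝔢 G) = χ h • follandFock 𝔢 (G ∘ (placeBlock (v ↦ (dualPairι (k_v h))^{pairFrame_v}))⁻¹)`
  for EVERY Fock polynomial `G` in the big frame `𝔢 = cmBigFrame` — no small datum of any block shape, no product of sections;
  and `χ` is PINNED by the vacuum: `ω_∞(κ₀ h) (follandFock 𝔢 1) = χ h • follandFock 𝔢 1` (`…_one`).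

Consumers (successor leaves): `TorusLetters` (the components of E's chart point `(1, archDiag (dW S) u)` ARE diagonal letters,
so `omg_ins` = this headline + the torus dictionaries #14/#16 + ONE character identity on `T(L⁺ ⊗ ℝ)`), `KLetters` ((J-x₀)).
Nothing here is a claim of PerL/QW8.  Style lint (L-notation): no `local notation`.
-/

set_option autoImplicit false

noncomputable section

open NumberField NumberField.InfinitePlace IsDedekindDomain
open scoped Matrix Kronecker Classical TensorProduct ComplexConjugate
open MvPolynomial
open Literature.NumberTheory.Automorphic Literature.NumberTheory.Automorphic.UnitaryGroup Literature.NumberTheory.Weil1964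
open Literature.RepresentationTheory.HeisenbergGroup (polar symplecticGroup)
open Literature.RepresentationTheory.KonnoKonno2007 Literature.RepresentationTheory.KonnoKonno2007.RealDualPair
open Literature.NumberTheory.GelbartRogawski1991 Literature.NumberTheory.GelbartRogawski1991.UnitaryDualPair
open Literature.RepresentationTheory (atPlace)
open Literature.Analysis.SegalBargmann

namespace HodgeCM.Model.HypCensus

/-! ## §2 (generic) several places at once: realified block unitaries and their substitutions -/

section Generic

variable {ι o : Type} [Fintype ι] [DecidableEq ι] [Fintype o] [DecidableEq o]

/-- **Several-places form of `piPhaseHom_mulSingle_eq_realifySp`**: if every place component `g v` acts on its slice by a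
realified unitary `U v`, then `piPhaseHom ε Φ g` is the realified block unitary `placeBlock (v ↦ (U v)^{ε v})`.
[Weil1964, Chap. I n° 12, p. 160] -/
theorem piPhaseHom_eq_realifySp_placeBlock {σ : o → Type} [∀ v, Fintype (σ v)] [∀ v, DecidableEq (σ v)]
    {Gv : o → Type*} [∀ v, Group (Gv v)] (ε : ∀ v, ι ≃ σ v)
    (Φ : ∀ v, Gv v →* symplecticGroup (polar (dotPairing (σ v)))) (g : ∀ v, Gv v)
    (U : ∀ v, Matrix.unitaryGroup (σ v) ℂ) (hg : ∀ v, Φ v (g v) = realifySp (σ v) (U v)) :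
    piPhaseHom ε Φ g = realifySp (ι × o) (placeBlock fun v => reindexUnitary (ε v) (U v)) := by
  refine Subtype.ext (LinearEquiv.ext fun pq => ?_)
  change (⇑((piPhaseHom ε Φ g).1 : ((ι × o → ℝ) × (ι × o → ℝ)) ≃ₗ[ℝ] ((ι × o → ℝ) × (ι × o → ℝ))) : PhaseMap (ι × o)) pq =
    (⇑((realifySp (ι × o) (placeBlock fun v => reindexUnitary (ε v) (U v))).1 :
      ((ι × o → ℝ) × (ι × o → ℝ)) ≃ₗ[ℝ] ((ι × o → ℝ) × (ι × o → ℝ))) : PhaseMap (ι × o)) pq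
  rw [coe_piPhaseHom, coe_realifySp, realify_placeBlock]
  congr 1
  funext w
  rw [hg, coe_realifySp, reindexPhase_realify]

/-- **The substitution `F ↦ F ∘ (placeBlock U)⁻¹` acts place by place**: on a polynomial in the variables of the place `w`
it is the substitution by `U w`. [Folland1989, Prop. (4.39)] -/
theorem linSubst_star_placeBlock_rename_atPlace (U : o → Matrix.unitaryGroup ι ℂ) (w : o) (G : MvPolynomial ι ℂ) :
    linSubst (star ((placeBlock U : Matrix.unitaryGroup (ι × o) ℂ) : Matrix (ι × o) (ι × o) ℂ)) (rename (atPlace w) G) =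
      rename (atPlace w) (linSubst (star ((U w : Matrix.unitaryGroup ι ℂ) : Matrix ι ι ℂ)) G) := by
  have h : ((linSubst (star ((placeBlock U : Matrix.unitaryGroup (ι × o) ℂ) : Matrix (ι × o) (ι × o) ℂ))).comp
        (rename (atPlace w)) : MvPolynomial ι ℂ →ₐ[ℂ] MvPolynomial (ι × o) ℂ) =
      (rename (atPlace w)).comp (linSubst (star ((U w : Matrix.unitaryGroup ι ℂ) : Matrix ι ι ℂ))) := by
    refine MvPolynomial.algHom_ext fun i => ?_
    rw [AlgHom.comp_apply, AlgHom.comp_apply, rename_X, linSubst_star_placeBlock_X, linSubst_X, map_sum]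
    refine Finset.sum_congr rfl fun j _ => ?_
    rw [map_mul, rename_C, rename_X, Matrix.star_apply]
  exact congrArg (fun φ : MvPolynomial ι ℂ →ₐ[ℂ] MvPolynomial (ι × o) ℂ => φ G) h

/-- … hence on a product of place polynomials it substitutes each factor by its own block. -/
theorem linSubst_star_placeBlock_prod_rename_atPlace (U : o → Matrix.unitaryGroup ι ℂ) (G : o → MvPolynomial ι ℂ) :
    linSubst (star ((placeBlock U : Matrix.unitaryGroup (ι × o) ℂ) : Matrix (ι × o) (ι × o) ℂ))
        (∏ w, rename (atPlace w) (G w)) =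
      ∏ w, rename (atPlace w) (linSubst (star ((U w : Matrix.unitaryGroup ι ℂ) : Matrix ι ι ℂ)) (G w)) := by
  rw [map_prod]
  exact Finset.prod_congr rfl fun w _ => linSubst_star_placeBlock_rename_atPlace U w (G w)

/-- **transport of the substitution along a reindexing of the variables**: substituting by the reindexed unitary `U^ε` is
the substitution by `U` read through `rename`. [folklore] -/
theorem linSubst_star_reindexUnitary_rename {σ σ' : Type} [Fintype σ] [DecidableEq σ] [Fintype σ'] [DecidableEq σ']
    (ε : σ ≃ σ') (U : Matrix.unitaryGroup σ' ℂ) (G : MvPolynomial σ' ℂ) :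
    linSubst (star ((reindexUnitary ε U : Matrix.unitaryGroup σ ℂ) : Matrix σ σ ℂ)) (rename ε.symm G) =
      rename ε.symm (linSubst (star ((U : Matrix.unitaryGroup σ' ℂ) : Matrix σ' σ' ℂ)) G) := by
  have h : ((linSubst (star ((reindexUnitary ε U : Matrix.unitaryGroup σ ℂ) : Matrix σ σ ℂ))).comp (rename ε.symm) :
        MvPolynomial σ' ℂ →ₐ[ℂ] MvPolynomial σ ℂ) =
      (rename ε.symm).comp (linSubst (star ((U : Matrix.unitaryGroup σ' ℂ) : Matrix σ' σ' ℂ))) := by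
    refine MvPolynomial.algHom_ext fun y => ?_
    rw [AlgHom.comp_apply, AlgHom.comp_apply, rename_X, linSubst_X, linSubst_X, map_sum, ← Equiv.sum_comp ε]
    refine Finset.sum_congr rfl fun j _ => ?_
    rw [map_mul, rename_C, rename_X, Matrix.star_apply, Matrix.star_apply, reindexUnitary_apply, Equiv.apply_symm_apply,
      Equiv.symm_apply_apply]
  exact congrArg (fun φ : MvPolynomial σ' ℂ →ₐ[ℂ] MvPolynomial σ ℂ => φ G) h

end Generic

/-! ## §1 Place components of an archimedean pair element of the CM pin -/

section CMPin

variable (L : Type) [Field L] [NumberField L] [IsCMField L] {N M n : ℕ} (e : Fin N × Fin M ≃ Fin n)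
variable (dV : Fin N → L) (hdV : ∀ i, IsCMField.complexConj L (dV i) = dV i) (hdV0 : ∀ i, dV i ≠ 0)
variable (dW : Fin M → L) (hdW : ∀ i, IsCMField.complexConj L (dW i) = dW i) (hdW0 : ∀ i, dW i ≠ 0)
variable (hGR : (cmSplittingDatum L e dV hdV hdV0 dW hdW hdW0).CompatibleSplitting) (ι₁ : L →+* ℂ)

/-- **the place component at the real place `v`** of an archimedean pair element, in the canonical block frames of the pin:
`U(J_V)(L ⊗ ℝ) × U(J_W)(L ⊗ ℝ) →* U(P_v,Q_v) × U(R_v,S_v)` (tree `archPairPlace v` along `archProdHom`). -/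
abbrev cmPlaceComponent (v : {v : InfinitePlace ↥(maximalRealSubfield L) // v.IsReal}) :
    UnitaryGroup.arch (↥(maximalRealSubfield L)) L (IsCMField.complexConj L) N (Matrix.diagonal dV) ×
        UnitaryGroup.arch (↥(maximalRealSubfield L)) L (IsCMField.complexConj L) M (Matrix.diagonal dW) →*
      Ginf (PosIdx (cmXV L dV hdV ι₁ v)) (NegIdx (cmXV L dV hdV ι₁ v)) (PosIdx (cmXW L dV dW hdW ι₁ v))
        (NegIdx (cmXW L dV dW hdW ι₁ v)) :=
  (archPairPlace L (IsCMField.complexConj L) N M (IsCMField.complexConj_ne_one L) (cmPlaceOver L) (cmPlaceOver_smul L)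
      (cmPlaceOver_comap L) (cmRealVec L dV hdV) (cmRealVec L dW hdW) (realDiagonal_map L dV hdV).symm
      (realDiagonal_map L dW hdW).symm (cmEpsV L dV hdV ι₁) (cmEpsW L dV dW hdW ι₁) (cmDV_ne_zero L dV hdV hdV0 ι₁)
      (cmDW_ne_zero L dV dW hdW hdW0 ι₁) (cmSignConv_ne_zero L dV ι₁) (cmCW_ne_zero L dV ι₁) (cm_htV L dV hdV hdV0 ι₁)
      (cm_htW L dV dW hdW hdW0 ι₁) v).comp
    (archProdHom (↥(maximalRealSubfield L)) L (IsCMField.complexConj L) N M (Matrix.diagonal dV) (Matrix.diagonal dW))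

/-- **the (J-arch) phase homomorphism of the pin IS `piPhaseHom` of Konno–Konno's `ι𝕎` along the place components**
(frames `pairFrame … e (cmEpsV v) (cmEpsW v)`); definitional. -/
theorem cmArchPairPhaseHom_apply
    (p : UnitaryGroup.arch (↥(maximalRealSubfield L)) L (IsCMField.complexConj L) N (Matrix.diagonal dV) ×
      UnitaryGroup.arch (↥(maximalRealSubfield L)) L (IsCMField.complexConj L) M (Matrix.diagonal dW)) :
    cmArchPairPhaseHom L e dV hdV hdV0 dW hdW hdW0 ι₁ p =
      piPhaseHom
        (fun v => pairFrame (PosIdx (cmXV L dV hdV ι₁ v)) (NegIdx (cmXV L dV hdV ι₁ v)) (PosIdx (cmXW L dV dW hdW ι₁ v))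
          (NegIdx (cmXW L dV dW hdW ι₁ v)) e (cmEpsV L dV hdV ι₁ v) (cmEpsW L dV dW hdW ι₁ v))
        (fun v => ι𝕎 (PosIdx (cmXV L dV hdV ι₁ v)) (NegIdx (cmXV L dV hdV ι₁ v)) (PosIdx (cmXW L dV dW hdW ι₁ v))
          (NegIdx (cmXW L dV dW hdW ι₁ v)))
        (fun v => cmPlaceComponent L dV hdV hdV0 dW hdW hdW0 ι₁ v p) := rfl

/-! ## §3 The compact-letters theorem -/

variable {H : Type*} [Group H] [TopologicalSpace H]

/-- the block unitary of the big frame read off a family of compact letters `k_v h ∈ K_{V,v} × K_{W,v}`: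
`placeBlock (v ↦ (dualPairι (k_v h))^{pairFrame_v})`, a monoid hom in `h`. -/
abbrev cmLetterBlock
    (k : ∀ v : {v : InfinitePlace ↥(maximalRealSubfield L) // v.IsReal},
      H →* DPK (PosIdx (cmXV L dV hdV ι₁ v)) (NegIdx (cmXV L dV hdV ι₁ v)) (PosIdx (cmXW L dV dW hdW ι₁ v))
        (NegIdx (cmXW L dV dW hdW ι₁ v))) :
    H →* Matrix.unitaryGroup (Fin n × {v : InfinitePlace ↥(maximalRealSubfield L) // v.IsReal}) ℂ :=
  placeBlockHom.comp (MonoidHom.pi fun v =>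
    (reindexUnitary (pairFrame (PosIdx (cmXV L dV hdV ι₁ v)) (NegIdx (cmXV L dV hdV ι₁ v)) (PosIdx (cmXW L dV dW hdW ι₁ v))
      (NegIdx (cmXW L dV dW hdW ι₁ v)) e (cmEpsV L dV hdV ι₁ v) (cmEpsW L dV dW hdW ι₁ v))).comp
      (dualPairι.comp (k v)))

omit [TopologicalSpace H] in
/-- unfolding the letter block (definitional): `cmLetterBlock k h = placeBlock (v ↦ (dualPairι (k_v h))^{pairFrame_v})`. -/
theorem cmLetterBlock_apply
    (k : ∀ v : {v : InfinitePlace ↥(maximalRealSubfield L) // v.IsReal},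
      H →* DPK (PosIdx (cmXV L dV hdV ι₁ v)) (NegIdx (cmXV L dV hdV ι₁ v)) (PosIdx (cmXW L dV dW hdW ι₁ v))
        (NegIdx (cmXW L dV dW hdW ι₁ v))) (h : H) :
    cmLetterBlock L e dV hdV dW hdW ι₁ k h =
      placeBlock fun v => reindexUnitary (pairFrame (PosIdx (cmXV L dV hdV ι₁ v)) (NegIdx (cmXV L dV hdV ι₁ v))
        (PosIdx (cmXW L dV dW hdW ι₁ v)) (NegIdx (cmXW L dV dW hdW ι₁ v)) e (cmEpsV L dV hdV ι₁ v) (cmEpsW L dV dW hdW ι₁ v))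
        (dualPairι (k v h)) := rfl

omit [TopologicalSpace H] in
/-- **if every place component of `κ₀ h` is the compact letter `κ (k_v h)`, the pin's phase map of `κ₀ h` is the realified
letter block.** -/
theorem cmArchPairPhaseHom_eq_realifySp_of_components
    (κ₀ : H →* UnitaryGroup.arch (↥(maximalRealSubfield L)) L (IsCMField.complexConj L) N (Matrix.diagonal dV) ×
      UnitaryGroup.arch (↥(maximalRealSubfield L)) L (IsCMField.complexConj L) M (Matrix.diagonal dW))
    (k : ∀ v : {v : InfinitePlace ↥(maximalRealSubfield L) // v.IsReal},
      H →* DPK (PosIdx (cmXV L dV hdV ι₁ v)) (NegIdx (cmXV L dV hdV ι₁ v)) (PosIdx (cmXW L dV dW hdW ι₁ v))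
        (NegIdx (cmXW L dV dW hdW ι₁ v)))
    (hk : ∀ v h, cmPlaceComponent L dV hdV hdV0 dW hdW hdW0 ι₁ v (κ₀ h) = κ _ _ _ _ (k v h)) (h : H) :
    cmArchPairPhaseHom L e dV hdV hdV0 dW hdW hdW0 ι₁ (κ₀ h) =
      realifySp _ (cmLetterBlock L e dV hdV dW hdW ι₁ k h) :=
  (cmArchPairPhaseHom_apply L e dV hdV hdV0 dW hdW hdW0 ι₁ (κ₀ h)).trans
    (piPhaseHom_eq_realifySp_placeBlock _ _ _ (fun v => dualPairι (k v h)) fun v => by rw [hk v h, ι𝕎_κ])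

/-- **COMPACT LETTERS AT ALL PLACES — HEADLINE.**  Under the sign facts of the pin (`V` of real rank `≤ 1` and `W` definite
through `ι₁`, `V` definite and `W` of real rank `≤ 1` elsewhere), for `κ₀ : H →* arch J_V × arch J_W` continuous whose place
components are compact letters `κ (k_v h)`: ONE continuous unitary character `χ` of `H` with
`ω_∞(κ₀ h) (follandFock 𝔢 G) = χ h • follandFock 𝔢 (G ∘ (letter block)⁻¹)` for every Fock polynomial `G` of the big frame
`𝔢 = cmBigFrame`. [Folland1989, Prop. (4.39); Weil1964, Chap. I n° 12] -/
theorem exists_character_cmArchWeilRep_follandFock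
    (h₁V : ∃ i₀ : Fin N, (∀ i, i ≠ i₀ → 0 < (ι₁ (dV i)).re) ∨ ∀ i, i ≠ i₀ → (ι₁ (dV i)).re < 0)
    (h₁W : (∀ j, 0 < (ι₁ (dW j)).re) ∨ ∀ j, (ι₁ (dW j)).re < 0)
    (hV : ∀ τ : L →+* ℂ, InfinitePlace.mk τ ≠ InfinitePlace.mk ι₁ →
      (∀ i, 0 < (τ (dV i)).re) ∨ ∀ i, (τ (dV i)).re < 0)
    (hW : ∀ τ : L →+* ℂ, InfinitePlace.mk τ ≠ InfinitePlace.mk ι₁ →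
      (∃ j₀ : Fin M, ∀ j, j ≠ j₀ → 0 < (τ (dW j)).re) ∨ ∀ j, (τ (dW j)).re < 0)
    (κ₀ : H →* UnitaryGroup.arch (↥(maximalRealSubfield L)) L (IsCMField.complexConj L) N (Matrix.diagonal dV) ×
      UnitaryGroup.arch (↥(maximalRealSubfield L)) L (IsCMField.complexConj L) M (Matrix.diagonal dW))
    (hκ₀ : Continuous κ₀)
    (k : ∀ v : {v : InfinitePlace ↥(maximalRealSubfield L) // v.IsReal},
      H →* DPK (PosIdx (cmXV L dV hdV ι₁ v)) (NegIdx (cmXV L dV hdV ι₁ v)) (PosIdx (cmXW L dV dW hdW ι₁ v))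
        (NegIdx (cmXW L dV dW hdW ι₁ v)))
    (hk : ∀ v h, cmPlaceComponent L dV hdV hdV0 dW hdW hdW0 ι₁ v (κ₀ h) = κ _ _ _ _ (k v h)) :
    ∃ χ : H →* Circle, Continuous χ ∧
      ∀ (h : H) (G : MvPolynomial (Fin n × {v : InfinitePlace ↥(maximalRealSubfield L) // v.IsReal}) ℂ),
        cmArchWeilRep L e dV hdV hdV0 dW hdW hdW0 hGR (κ₀ h) (follandFock (cmBigFrame L e dV hdV hdV0 dW hdW hdW0 ι₁) G) =
          ((χ h : Circle) : ℂ) •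
            follandFock (cmBigFrame L e dV hdV hdV0 dW hdW hdW0 ι₁)
              (linSubst (star ((cmLetterBlock L e dV hdV dW hdW ι₁ k h :
                Matrix.unitaryGroup (Fin n × {v : InfinitePlace ↥(maximalRealSubfield L) // v.IsReal}) ℂ) :
                  Matrix _ _ ℂ)) G) := by
  have hWD : IsArchWeilDatum (cmArchPairPhaseHom L e dV hdV hdV0 dW hdW hdW0 ι₁)
      (repTransport (cmBigFrame L e dV hdV hdV0 dW hdW hdW0 ι₁) (cmArchWeilRep L e dV hdV hdV0 dW hdW hdW0 hGR)) :=
    isArchWeilDatum_repTransport_cmArchWeilRep_of_signs L e dV hdV hdV0 dW hdW hdW0 hGR ι₁ h₁V h₁W hV hW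
  obtain ⟨χ, hχ, hω⟩ := hWD.exists_eq_compactWeilRep κ₀ hκ₀ (cmLetterBlock L e dV hdV dW hdW ι₁ k)
    (cmArchPairPhaseHom_eq_realifySp_of_components L e dV hdV hdV0 dW hdW hdW0 ι₁ κ₀ k hk)
  refine ⟨χ, hχ, fun h G => ?_⟩
  have h1 := hω h (binvPi G)
  rw [repTransport_apply, compactWeilRep_binvPi] at h1
  have h2 := congrArg (schwartzTransport (cmBigFrame L e dV hdV hdV0 dW hdW hdW0 ι₁)).symm h1
  rw [ContinuousLinearEquiv.symm_apply_apply, map_smul] at h2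
  exact h2

omit [TopologicalSpace H] in
/-- **the character is PINNED by the vacuum**: `ω_∞(κ₀ h) (follandFock 𝔢 1) = χ h • follandFock 𝔢 1`. -/
theorem character_pinned_by_vacuum
    (κ₀ : H →* UnitaryGroup.arch (↥(maximalRealSubfield L)) L (IsCMField.complexConj L) N (Matrix.diagonal dV) ×
      UnitaryGroup.arch (↥(maximalRealSubfield L)) L (IsCMField.complexConj L) M (Matrix.diagonal dW))
    (k : ∀ v : {v : InfinitePlace ↥(maximalRealSubfield L) // v.IsReal},
      H →* DPK (PosIdx (cmXV L dV hdV ι₁ v)) (NegIdx (cmXV L dV hdV ι₁ v)) (PosIdx (cmXW L dV dW hdW ι₁ v))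
        (NegIdx (cmXW L dV dW hdW ι₁ v)))
    (χ : H →* Circle)
    (hχ : ∀ (h : H) (G : MvPolynomial (Fin n × {v : InfinitePlace ↥(maximalRealSubfield L) // v.IsReal}) ℂ),
        cmArchWeilRep L e dV hdV hdV0 dW hdW hdW0 hGR (κ₀ h) (follandFock (cmBigFrame L e dV hdV hdV0 dW hdW hdW0 ι₁) G) =
          ((χ h : Circle) : ℂ) •
            follandFock (cmBigFrame L e dV hdV hdV0 dW hdW hdW0 ι₁)
              (linSubst (star ((cmLetterBlock L e dV hdV dW hdW ι₁ k h :
                Matrix.unitaryGroup (Fin n × {v : InfinitePlace ↥(maximalRealSubfield L) // v.IsReal}) ℂ) :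
                  Matrix _ _ ℂ)) G)) (h : H) :
    cmArchWeilRep L e dV hdV hdV0 dW hdW hdW0 hGR (κ₀ h) (follandFock (cmBigFrame L e dV hdV hdV0 dW hdW hdW0 ι₁) 1) =
      ((χ h : Circle) : ℂ) • follandFock (cmBigFrame L e dV hdV hdV0 dW hdW hdW0 ι₁) 1 := by
  rw [hχ h 1, map_one]

end CMPin

end HodgeCM.Model.HypCensus

end
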